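import Summits.ABC.ABC.Theorems.TwistAmplificationMazurKaneLawSliceClassBoundHigh
import Summits.ABC.ABC.Theorems.TwistAmplificationMazurKaneLawSliceReduction

/-!
# The Hooley-free lever for the high slices (line `peyre-level-torsor-v22`, crux stmt-ABC-2757)

Lead prover-line-stmt-ABC-2757-0, 2026-08-16 (reshape 2). The registered high-range stub of the line is the slice law
`SliceLawHigh` (Mazur–Kane density on the radical slices `rad(abc) ∈ (c^{s-η}, c^s]`, `s ∈ [5/3, 2)`). This file lands the
kernel-checked SUFFICIENT CONDITION recommended for it: the shape-level torsor bound RESTRICTED to high-slice classes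
("`ShapeLevelBoundOnHighSlices`": the bound `shapeCount ≤ K (c₃ shapeVal Z)^ε (∏_{i≥2} XᵢYᵢZᵢ + ∏ XᵢYᵢZᵢ/(c₃ shapeVal Z))`
asked only on data admissible for exponent `s + ε`, `s ∈ [5/3,2)`, that carry the radical lower bound of the slice with a
window `η ≤ 1/12`, `K` depending on `(s, ε, η)`), composed from the landed `SliceClassBoundHigh` (p76737) and the landed slice
reduction `SliceReduction` (p73080) with `card_classRange_le`: `HighSliceLever : ShapeLevelBoundOnHighSlices ⟹ SliceLawHigh`.
Unlike the unrestricted lever `LevelTorsorBound` (which contains the Pell box count, `LeverPellBox`), the restricted hypothesis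
excludes the Pell classes `(du², 1, t²)` (`∏P = C₀^{3/2}/U` is incompatible with the lower bound at `s - η ≥ 19/12` for large
`C₀`). Parameters: shape `ε₁ = min(ε/20, 1/4)`, window `η = min(ε/4, 1/12)`, class-count slack `ε/4`.
-/

namespace Summit.ABC.ABC.Theorems

open Literature.NumberTheory.DiophantineGeometry
open Literature.NumberTheory.DiophantineGeometry.AbcShapes

/-- **Restricted lever ⟹ slice law on `[5/3, 2)`** (registered name `HighSliceLever`): if the shape-level torsor bound
holds on all high-slice class data (hypothesis, verbatim the antecedent of the landed `SliceClassBoundHigh`), then for every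
`ε > 0` there is a window `η > 0` such that for all `s ∈ [5/3, 2)`:
`#{abc : c ≤ N, c^{s-η} < rad(abc) ≤ c^s} ≤ C N^{s-1+ε}` (`N ≥ 2`). [folklore] -/
theorem HighSliceLever : (∀ s : ℝ, 5 / 3 ≤ s → s < 2 → ∀ ε : ℝ, 0 < ε → ε ≤ 1 / 4 → ∀ η : ℝ, 0 < η → η ≤ 1 / 12 → ∃ K : ℝ, ∀ (C₀ c₁ c₂ c₃ : ℕ) (X Y Z : Fin (Literature.NumberTheory.DiophantineGeometry.AbcShapes.numShapes ε) → ℕ), Literature.NumberTheory.DiophantineGeometry.AbcShapes.Admissible (s + ε) ε C₀ c₁ c₂ c₃ X Y Z → ((C₀ : ℝ) ^ (s - η) ≤ (2 * (C₀ : ℝ)) ^ (3 * ε / 2) * (8 : ℝ) ^ (Literature.NumberTheory.DiophantineGeometry.AbcShapes.numShapes ε) * ∏ i, ((X i : ℝ) * Y i * Z i)) → (Literature.NumberTheory.DiophantineGeometry.AbcShapes.shapeCount c₁ c₂ c₃ X Y Z : ℝ) ≤ K * ((c₃ : ℝ) * ((Literature.NumberTheory.DiophantineGeometry.AbcShapes.shapeVal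 Z : ℕ) : ℝ)) ^ ε * ((∏ i ∈ Finset.univ.filter (fun i : Fin (Literature.NumberTheory.DiophantineGeometry.AbcShapes.numShapes ε) => 2 ≤ (i : ℕ)), ((X i : ℝ) * Y i * Z i)) + (∏ i, ((X i : ℝ) * Y i * Z i)) / ((c₃ : ℝ) * ((Literature.NumberTheory.DiophantineGeometry.AbcShapes.shapeVal Z : ℕ) : ℝ)))) → ∀ ε : ℝ, 0 < ε → ∃ η : ℝ, 0 < η ∧ ∀ s : ℝ, 5 / 3 ≤ s → s < 2 → ∃ C : ℝ, ∀ N : ℕ, 2 ≤ N → (Set.ncard {t : ℕ × ℕ × ℕ | Literature.NumberTheory.DiophantineGeometry.IsABCTriple t.1 t.2.1 t.2.2 ∧ t.2.2 ≤ N ∧ (t.2.2 : ℝ) ^ (s - η) < ((Literature.NumberTheory.DiophantineGeometry.rad t.1 t.2.1 t.2.2 : ℕ) : ℝ) ∧ ((Literature.NumberTheory.DiophantineGeometry.rad t.1 t.2.1 t.2.2 : ℕ) : ℝ) ≤ (t.2.2 : ℝ) ^ s} : ℝ) ≤ C * (N : ℝ) ^ (s - 1 + ε) := by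
  intro hLever ε hε
  obtain ⟨ε₁, hε₁⟩ : ∃ t : ℝ, t = min (ε / 20) (1 / 4) := ⟨_, rfl⟩
  obtain ⟨η, hη⟩ : ∃ t : ℝ, t = min (ε / 4) (1 / 12) := ⟨_, rfl⟩
  have hε₁0 : 0 < ε₁ := by rw [hε₁]; exact lt_min (by positivity) (by norm_num)
  have hε₁4 : ε₁ ≤ 1 / 4 := by rw [hε₁]; exact min_le_right _ _
  have hε₁ε : ε₁ ≤ ε / 20 := by rw [hε₁]; exact min_le_left _ _
  have hη0 : 0 < η := by rw [hη]; exact lt_min (by positivity) (by norm_num)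
  have hηε : η ≤ ε / 4 := by rw [hη]; exact min_le_left _ _
  have hη12 : η ≤ 1 / 12 := by rw [hη]; exact min_le_right _ _
  refine ⟨η, hη0, fun s hs53 hs2 => ?_⟩
  obtain ⟨K, hK0, hK⟩ := SliceClassBoundHigh hLever s hs53 hs2 ε₁ hε₁0 hε₁4 η hη0 hη12
  have hθ0 : 0 ≤ s - 1 + 5 * ε₁ + η := by linarith
  have hred := SliceReduction s (by linarith) hs2 ε₁ hε₁0 hε₁4 η hη0 (by linarith) _ K hθ0 hK0 hK
  obtain ⟨C, hC0, hC⟩ := card_classRange_le ε₁ (δ := ε / 4) (by positivity)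
  refine ⟨K * C, fun N hN => ?_⟩
  have hN1 : (1 : ℝ) ≤ N := by exact_mod_cast (by omega : 1 ≤ N)
  have hN0 : (0 : ℝ) < N := by positivity
  have hexp : (N : ℝ) ^ (3 * ε₁ / 2 + ε / 4) * (N : ℝ) ^ (s - 1 + 5 * ε₁ + η) ≤ (N : ℝ) ^ (s - 1 + ε) := by
    rw [← Real.rpow_add hN0]
    exact Real.rpow_le_rpow_of_exponent_le hN1 (by linarith)
  calc (Set.ncard {t : ℕ × ℕ × ℕ | IsABCTriple t.1 t.2.1 t.2.2 ∧ t.2.2 ≤ N ∧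
          (t.2.2 : ℝ) ^ (s - η) < ((rad t.1 t.2.1 t.2.2 : ℕ) : ℝ) ∧
          ((rad t.1 t.2.1 t.2.2 : ℕ) : ℝ) ≤ (t.2.2 : ℝ) ^ s} : ℝ)
        ≤ K * (classRange ε₁ N).card * (N : ℝ) ^ (s - 1 + 5 * ε₁ + η) := hred N
    _ ≤ K * (C * (N : ℝ) ^ (3 * ε₁ / 2 + ε / 4)) * (N : ℝ) ^ (s - 1 + 5 * ε₁ + η) :=
        mul_le_mul_of_nonneg_right (mul_le_mul_of_nonneg_left (hC N hN) hK0) (by positivity)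
    _ = K * C * ((N : ℝ) ^ (3 * ε₁ / 2 + ε / 4) * (N : ℝ) ^ (s - 1 + 5 * ε₁ + η)) := by ring
    _ ≤ K * C * (N : ℝ) ^ (s - 1 + ε) := mul_le_mul_of_nonneg_left hexp (mul_nonneg hK0 hC0.le)

end Summit.ABC.ABC.Theorems
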